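import Summits.ValiantsHypothesis.ValiantsHypothesis.Theorems.SymmetroidPencilBasics
import Summits.ValiantsHypothesis.ValiantsHypothesis.Theorems.LacunarySymmetroidMatrixDescartesStubReverse

/-!
# `WeakLifting`, line (B) `tower_graft` — calibration: a two-sided `2 × 2` pencil with `Z₊ ≥ 8` on the 2-tower `(0, 10, 21, 43, 87)`

Crux `stmt-ValiantsHypothesis-19561` (`Theses.KPlusLogSqLaw.WeakLifting`), restricted sub-case of the line
`Cruxes/WeakLifting/Lines/tower_graft.lean` (tower supports).  Companion of `…TowerGraftTowerTwoSidedWitness` (`T₂₄`: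
`Z₊ ≥ 6 > 2m` on `(0,1,3,7)`): the same word `X^e • J + ∑ₖ X^{dₖ} • Pₖ` (`Pₖ ⪰ 0`, one symmetric pivot letter `J`) with
`K = 5` letters on the 2-tower `(0, 10, 21, 43, 87)` (`2·x < y` for all exponents `x < y`), pivot exponent `e = 10` (1 PSD exponent(s) below,
3 above), reaches `Z₊ ≥ 8 = 4m` (the Descartes ceiling `2(b+1) = 8` of that cell: SATURATED): `det` alternates in sign at
the 9 rational points `1/4, 1/2, 7/8, 15/16, 31/32, 1, 65/64, 17/16, 2` (`+,-,+,-,+,-,+,-,+`).  Letters (integers):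
`J = [[-96815128, 34538560], [34538560, 35783032]]` (`det J < 0`), `Pₖ = uₖuₖᵀ + u'ₖu'ₖᵀ` with
`u = [(7741, -8283), (641, -103), (-6391, -14685), (3398, 7706)]`, `u' = [(0, -18), (0, -11568), (0, 28), (0, 25)]` at exponents
`[0, 21, 43, 87]`.  Found by zero-forcing Levenberg–Marquardt and integerised at scale 4096 (compute job `liftp3-f25-stratum`
j319487 of the cell `pub-symmetroid`, task `tower-K5-0_10_21_43_87-p1-Z8`, exactly certified there with rational letters);
it prices the K-dependence of the two-sided excess over `2m` ON towers at `m = 2` (Descartes ceiling on a 2-tower for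
this word: `2(b+1)` if `J ⪯ 0`, `2(⌊a/2⌋+b+1)` if `J` is indefinite, `(a,b) = (1,3)`).
Harmless to `TowerB` (polynomial counts are absorbed by `2^{C(K + log² m)}`).

[folklore] Elementary; the sign pattern is a `norm_num` certificate at rational points.
-/

-- `Summit.ValiantsHypothesis.ValiantsHypothesis.…` repeats a component by the D-0017 layout
-- (single-conjunct summit), which the `dupNamespace` linter flags; the name is mandated.
set_option linter.dupNamespace false

namespace Summit.ValiantsHypothesis.ValiantsHypothesis.Theorems.KPlusLogSqLaw.TowerGraft

open Summit.ValiantsHypothesis.ValiantsHypothesis.Theorems.SymmetroidDescartes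
  (le_card_posRoots_of_alternating)
open Summit.ValiantsHypothesis.ValiantsHypothesis.Theorems.LacunarySymmetroidMatrixDescartes (StubReverse.eval_det_pencil)
open scoped BigOperators Matrix
open Polynomial

namespace TowerTwoSidedWitnessEight

/-- the vectors `uₖ` of the PSD letters `Pₖ = uₖuₖᵀ + u'ₖu'ₖᵀ` -/
def u₅₈ : Fin 4 → Fin 2 → ℝ := ![![7741, -8283], ![641, -103], ![-6391, -14685], ![3398, 7706]]

/-- the vectors `u'ₖ = (0, ·)` of the PSD letters -/
def u'₅₈ : Fin 4 → Fin 2 → ℝ := ![![0, -18], ![0, -11568], ![0, 28], ![0, 25]]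

/-- the PSD letters `Pₖ = uₖuₖᵀ + u'ₖu'ₖᵀ` -/
def P₅₈ (k : Fin 4) : Matrix (Fin 2) (Fin 2) ℝ :=
  Matrix.vecMulVec (u₅₈ k) (u₅₈ k) + Matrix.vecMulVec (u'₅₈ k) (u'₅₈ k)

/-- their exponents `(0, 21, 43, 87)` -/
def d₅₈ : Fin 4 → ℕ := ![0, 21, 43, 87]

/-- the pivot exponent `e = 10` -/
def e₅₈ : ℕ := 10

/-- the pivot letter `J` -/
def J₅₈ : Matrix (Fin 2) (Fin 2) ℝ := !![-96815128, 34538560; 34538560, 35783032]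

/-- the witness pencil `X^e • J + ∑ₖ X^{dₖ} • Pₖ` (the `stub_twoSided` currency) -/
noncomputable def T₅₈ : Matrix (Fin 2) (Fin 2) ℝ[X] :=
  ((X : ℝ[X]) ^ e₅₈) • J₅₈.map Polynomial.C + ∑ k, ((X : ℝ[X]) ^ d₅₈ k) • (P₅₈ k).map Polynomial.C

/-- `J` is symmetric -/
theorem J₅₈_isSymm : J₅₈.IsSymm := by
  unfold Matrix.IsSymm J₅₈
  ext i j
  fin_cases i <;> fin_cases j <;> simp

/-- `J` is indefinite (`det J < 0`) -/
theorem det_J₅₈_neg : J₅₈.det < 0 := by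
  simp [J₅₈, Matrix.det_fin_two]
  norm_num

/-- every `Pₖ` is positive semidefinite -/
theorem P₅₈_posSemidef (k : Fin 4) : (P₅₈ k).PosSemidef := by
  have h1 := Matrix.posSemidef_vecMulVec_self_star (R := ℝ) (u₅₈ k)
  have h2 := Matrix.posSemidef_vecMulVec_self_star (R := ℝ) (u'₅₈ k)
  rw [star_trivial] at h1 h2
  exact h1.add h2

/-- the witness is two-sided: PSD exponents on both sides of the pivot -/
theorem twoSided₅₈ : (∃ k, d₅₈ k < e₅₈) ∧ (∃ k, e₅₈ < d₅₈ k) :=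
  ⟨⟨0, by simp [d₅₈, e₅₈]⟩, ⟨1, by simp [d₅₈, e₅₈]⟩⟩

/-- the support is a genuine 2-TOWER (`2·x < y` for all exponents `x < y`), stated pairwise -/
theorem tower₅₈ : (∀ k, d₅₈ k < e₅₈ → 2 * d₅₈ k < e₅₈) ∧ (∀ k, e₅₈ < d₅₈ k → 2 * e₅₈ < d₅₈ k) ∧
    (∀ k k', d₅₈ k < d₅₈ k' → 2 * d₅₈ k < d₅₈ k') := by
  refine ⟨?_, ?_, ?_⟩
  · intro k; fin_cases k <;> simp [d₅₈, e₅₈]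
  · intro k; fin_cases k <;> simp [d₅₈, e₅₈]
  · intro k k'; fin_cases k <;> fin_cases k' <;> simp [d₅₈]

/-- `det T(t)` in closed form -/
theorem eval_det_T₅₈ (t : ℝ) :
    (T₅₈.det).eval t =
      (59923081 - 96815128 * t ^ 10 + 410881 * t ^ 21 + 40844881 * t ^ 43 + 11546404 * t ^ 87) *
          (68608413 + 35783032 * t ^ 10 + 133829233 * t ^ 21 + 215650009 * t ^ 43 + 59383061 * t ^ 87) -
        (-64118703 + 34538560 * t ^ 10 - 66023 * t ^ 21 + 93851835 * t ^ 43 + 26184988 * t ^ 87) ^ 2 := by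
  unfold T₅₈
  rw [StubReverse.eval_det_pencil]
  simp only [Matrix.det_fin_two, Fin.sum_univ_four, Matrix.add_apply, Matrix.smul_apply, P₅₈, u₅₈, u'₅₈,
    J₅₈, d₅₈, e₅₈, Matrix.vecMulVec_apply, Matrix.cons_val_zero, Matrix.cons_val_one, Matrix.cons_val_two,
    Matrix.cons_val_three, Matrix.tail_cons, Matrix.head_cons, Matrix.of_apply, Matrix.cons_val',
    Matrix.empty_val', Matrix.cons_val_fin_one, smul_eq_mul, pow_zero, one_mul]
  ring

/-- 9 positive test points -/
noncomputable def τ₅₈ : Fin 9 → ℝ := ![1/4, 1/2, 7/8, 15/16, 31/32, 1, 65/64, 17/16, 2]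

/-- the test points increase -/
theorem τ₅₈_strictMono : StrictMono τ₅₈ := by
  refine Fin.strictMono_iff_lt_succ.2 fun j => ?_
  fin_cases j <;> simp [τ₅₈] <;> norm_num

/-- the test points are positive -/
theorem τ₅₈_pos (j : Fin 9) : 0 < τ₅₈ j := by
  fin_cases j <;> simp [τ₅₈]

/-- `det T` alternates in sign along the test points (`norm_num` certificate; signs `+,-,+,-,+,-,+,-,+`) -/
theorem alt₅₈ (j : Fin 8) :
    (T₅₈.det).eval (τ₅₈ j.castSucc) * (T₅₈.det).eval (τ₅₈ j.succ) < 0 := by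
  fin_cases j <;> simp only [eval_det_T₅₈, τ₅₈] <;> simp <;> norm_num

/-- **`Z₊ ≥ 8`** for the two-sided `2 × 2` witness on the 2-tower `(0, 10, 21, 43, 87)`. -/
theorem le_card_posRoots_T₅₈ :
    8 ≤ (T₅₈.det.roots.toFinset.filter (fun t => 0 < t)).card :=
  le_card_posRoots_of_alternating _ 8 τ₅₈ τ₅₈_strictMono τ₅₈_pos alt₅₈

end TowerTwoSidedWitnessEight

open TowerTwoSidedWitnessEight

/-- Existential form: a two-sided `2 × 2` pencil with `K = 5` letters (`J` symmetric, indefinite, `Pₖ ⪰ 0` on both sides of the pivot)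
on a 2-TOWER support with at least `8` distinct positive zeros of its determinant. -/
theorem exists_tower_twoSided_card_ge_8 :
    ∃ (e : ℕ) (d : Fin 4 → ℕ) (J : Matrix (Fin 2) (Fin 2) ℝ) (P : Fin 4 → Matrix (Fin 2) (Fin 2) ℝ),
      J.IsSymm ∧ J.det < 0 ∧ (∀ k, (P k).PosSemidef) ∧ (∃ k, d k < e) ∧ (∃ k, e < d k) ∧
        (∀ k, d k < e → 2 * d k < e) ∧ (∀ k, e < d k → 2 * e < d k) ∧ (∀ k k', d k < d k' → 2 * d k < d k') ∧
        8 ≤ ((Matrix.det (((X : ℝ[X]) ^ e) • J.map Polynomial.C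
              + ∑ k, ((X : ℝ[X]) ^ d k) • (P k).map Polynomial.C)).roots.toFinset.filter
                (fun t => 0 < t)).card :=
  ⟨e₅₈, d₅₈, J₅₈, P₅₈, J₅₈_isSymm, det_J₅₈_neg, P₅₈_posSemidef, twoSided₅₈.1, twoSided₅₈.2, tower₅₈.1,
    tower₅₈.2.1, tower₅₈.2.2, le_card_posRoots_T₅₈⟩

end Summit.ValiantsHypothesis.ValiantsHypothesis.Theorems.KPlusLogSqLaw.TowerGraft
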